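import Mathlib
import HarnessLib
import Summits.HubbardSuperconductivity.HubbardSuperconductivity.Theorems.KLProgrammeFreeBandRadiusDerivTree
import Summits.HubbardSuperconductivity.HubbardSuperconductivity.Theorems.KLProgrammePerturbedFermiCurveWindowJetsDefs

/-!
# Route `KLProgramme` — ENGINE crux `KLRegimeEngineV17F2` (stmt-HubbardSuperconductivity-20437), row (C) `hcertA : KlwjCertA`:
# calculus of the radial slope `D_μ(θ) = ∂_tF(θ, u_μ(θ))` and the polar Jacobian `J_μ = u/D` along the free Fermi curve — closed forms of `D′`, `J′`,
# their `D₄` symmetry, and a generic certificate-tree checker (cell gate-hubbard-kl, seat p1b g19)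

* `hasDerivAt_freeRadialSlope` — `D′ = 2[(c sin k₂ − s sin k₁ + u c s (cos k₂ − cos k₁)) + (c² cos k₁ + s² cos k₂)·u′]` (`c = cos θ`, `s = sin θ`,
  `k₁ = u c`, `k₂ = u s`, `u′ = bandFermiRadiusDeriv μ θ`; chain rule over `hasDerivAt_bandFermiRadius`);
* `hasDerivAt_freePolarJac` — `J′ = (u′D − uD′)/D²`;
* `freeRadialSlope_neg/_add_pi_div_two`, `freePolarJac_neg/_add_pi_div_two` — both are EVEN and `π/2`-PERIODIC (from `bandFermiRadius_neg/_add_pi_div_two`);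
* `exists_octant_abs_deriv_eq` — for an even `π/2`-periodic `f`, every `|f′(θ)|` is attained on `[0, π/4]` (`deriv_comp_add_const`, `deriv_comp_const_sub`);
* `R1Tree.checkP p` / `R1Tree.soundP` — the bisection-tree checker of `…FreeBandRadiusDerivTree` with an arbitrary leaf test `p : R1Box → Bool` and its
  soundness for any box-local property.
Elementary; nothing about the Hubbard model is asserted. [folklore]
-/

noncomputable section

namespace Summit.HubbardSuperconductivity.HubbardSuperconductivity.Theorems.PerturbedFermiCurve

set_option linter.dupNamespace false -- summit = problem name (single-conjunct summit), D-0017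

open Real Set Literature.MathematicalPhysics.QuantumLattice

/-! ## §1 Closed forms of `D′` and `J′` -/

section Deriv

variable {μ : ℝ} (hμ₁ : -4 < μ) (hμ₂ : μ < 0)
include hμ₁ hμ₂

/-- **`D′` in closed form.** -/
theorem hasDerivAt_freeRadialSlope (θ : ℝ) :
    HasDerivAt (freeRadialSlope μ)
      (2 * ((Real.cos θ * Real.sin (bandFermiRadius μ θ * Real.sin θ) - Real.sin θ * Real.sin (bandFermiRadius μ θ * Real.cos θ) +
          bandFermiRadius μ θ * Real.cos θ * Real.sin θ *
            (Real.cos (bandFermiRadius μ θ * Real.sin θ) - Real.cos (bandFermiRadius μ θ * Real.cos θ))) +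
        (Real.cos θ ^ 2 * Real.cos (bandFermiRadius μ θ * Real.cos θ) + Real.sin θ ^ 2 * Real.cos (bandFermiRadius μ θ * Real.sin θ)) *
          bandFermiRadiusDeriv μ θ)) θ := by
  have hu := hasDerivAt_bandFermiRadius hμ₁ hμ₂ θ
  have hc := Real.hasDerivAt_cos θ
  have hs := Real.hasDerivAt_sin θ
  have h1 : HasDerivAt (fun x => bandFermiRadius μ x * Real.cos x)
      (bandFermiRadiusDeriv μ θ * Real.cos θ + bandFermiRadius μ θ * -Real.sin θ) θ := hu.mul hc
  have h2 := h1.sin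
  have h3 : HasDerivAt (fun x => Real.cos x * Real.sin (bandFermiRadius μ x * Real.cos x)) _ θ := hc.mul h2
  have h4 : HasDerivAt (fun x => bandFermiRadius μ x * Real.sin x)
      (bandFermiRadiusDeriv μ θ * Real.sin θ + bandFermiRadius μ θ * Real.cos θ) θ := hu.mul hs
  have h5 := h4.sin
  have h6 : HasDerivAt (fun x => Real.sin x * Real.sin (bandFermiRadius μ x * Real.sin x)) _ θ := hs.mul h5
  have h7 := (h3.add h6).const_mul (2 : ℝ)
  have e : freeRadialSlope μ = fun x => 2 * (Real.cos x * Real.sin (bandFermiRadius μ x * Real.cos x) +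
      Real.sin x * Real.sin (bandFermiRadius μ x * Real.sin x)) := by
    funext x; rw [freeRadialSlope, rayDispersionDt]
  rw [e]
  refine h7.congr_deriv ?_
  ring

/-- `D > 0` along the curve. -/
theorem freeRadialSlope_pos (θ : ℝ) : 0 < freeRadialSlope μ θ :=
  rayDispersionDt_bandFermiRadius_pos hμ₁ hμ₂ θ

/-- **`J′ = (u′D − uD′)/D²`.** -/
theorem hasDerivAt_freePolarJac (θ : ℝ) {D' : ℝ} (hD : HasDerivAt (freeRadialSlope μ) D' θ) :
    HasDerivAt (freePolarJac μ)
      ((bandFermiRadiusDeriv μ θ * freeRadialSlope μ θ - bandFermiRadius μ θ * D') / freeRadialSlope μ θ ^ 2) θ := by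
  have hu := hasDerivAt_bandFermiRadius hμ₁ hμ₂ θ
  have h := hu.div hD (freeRadialSlope_pos hμ₁ hμ₂ θ).ne'
  have e : freePolarJac μ = fun x => bandFermiRadius μ x / freeRadialSlope μ x := by
    funext x; rw [freePolarJac, freeRadialSlope]
  rw [e]; exact h

/-! ## §2 Symmetries: `D` and `J` are even and `π/2`-periodic -/

/-- `D_μ(−θ) = D_μ(θ)`. -/
theorem freeRadialSlope_neg (θ : ℝ) : freeRadialSlope μ (-θ) = freeRadialSlope μ θ := by
  simp only [freeRadialSlope, rayDispersionDt, bandFermiRadius_neg hμ₁ hμ₂, Real.cos_neg, Real.sin_neg, mul_neg, neg_mul, neg_neg]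

/-- `D_μ(θ + π/2) = D_μ(θ)`. -/
theorem freeRadialSlope_add_pi_div_two (θ : ℝ) : freeRadialSlope μ (θ + π / 2) = freeRadialSlope μ θ := by
  simp only [freeRadialSlope, rayDispersionDt, bandFermiRadius_add_pi_div_two hμ₁ hμ₂, Real.cos_add_pi_div_two,
    Real.sin_add_pi_div_two, mul_neg, Real.sin_neg, neg_mul, neg_neg]
  ring

/-- `J_μ(−θ) = J_μ(θ)`. -/
theorem freePolarJac_neg (θ : ℝ) : freePolarJac μ (-θ) = freePolarJac μ θ := by
  have h := freeRadialSlope_neg hμ₁ hμ₂ θ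
  simp only [freeRadialSlope] at h
  rw [freePolarJac, freePolarJac, bandFermiRadius_neg hμ₁ hμ₂]
  simp only [bandFermiRadius_neg hμ₁ hμ₂] at h
  rw [h]

/-- `J_μ(θ + π/2) = J_μ(θ)`. -/
theorem freePolarJac_add_pi_div_two (θ : ℝ) : freePolarJac μ (θ + π / 2) = freePolarJac μ θ := by
  have h := freeRadialSlope_add_pi_div_two hμ₁ hμ₂ θ
  simp only [freeRadialSlope] at h
  rw [freePolarJac, freePolarJac, bandFermiRadius_add_pi_div_two hμ₁ hμ₂]
  simp only [bandFermiRadius_add_pi_div_two hμ₁ hμ₂] at h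
  rw [h]

end Deriv

/-! ## §3 Even `π/2`-periodic functions: every `|f′(θ)|` is attained on `[0, π/4]` -/

/-- Periodicity by an integer multiple of the period. -/
theorem periodic_int_mul_aux {f : ℝ → ℝ} (hper : ∀ x, f (x + π / 2) = f x) (k : ℤ) (x : ℝ) : f (x + k * (π / 2)) = f x := by
  have hp : Function.Periodic f (π / 2) := hper
  exact (hp.int_mul k) x

/-- **`D₄` reduction of `|f′|`** for an even, `π/2`-periodic `f`. -/
theorem exists_octant_abs_deriv_eq {f : ℝ → ℝ} (heven : ∀ x, f (-x) = f x) (hper : ∀ x, f (x + π / 2) = f x) (θ : ℝ) :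
    ∃ θ' ∈ Icc 0 (π / 4), |deriv f θ| = |deriv f θ'| := by
  have hπ := Real.pi_pos
  -- reduce modulo π/2
  set k : ℤ := ⌊θ / (π / 2)⌋ with hk
  set θ₁ : ℝ := θ - k * (π / 2) with hθ₁
  have hθ₁0 : 0 ≤ θ₁ := by
    have := Int.floor_le (θ / (π / 2))
    rw [hθ₁]
    have h2 : (k : ℝ) * (π / 2) ≤ θ := by
      have := mul_le_mul_of_nonneg_right this (by positivity : (0:ℝ) ≤ π / 2)
      rwa [div_mul_cancel₀ _ (by positivity : (π / 2 : ℝ) ≠ 0)] at this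
    linarith
  have hθ₁lt : θ₁ < π / 2 := by
    have := Int.lt_floor_add_one (θ / (π / 2))
    rw [hθ₁]
    have h2 : θ < ((k : ℝ) + 1) * (π / 2) := by
      have := mul_lt_mul_of_pos_right this (by positivity : (0:ℝ) < π / 2)
      rwa [div_mul_cancel₀ _ (by positivity : (π / 2 : ℝ) ≠ 0)] at this
    linarith
  have hd1 : deriv f θ = deriv f θ₁ := by
    have e : (fun x => f (x + k * (π / 2))) = f := funext (periodic_int_mul_aux hper k)
    have h := deriv_comp_add_const f ((k : ℝ) * (π / 2)) θ₁
    rw [e] at h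
    rw [h, hθ₁]; congr 1; ring
  rcases le_or_gt θ₁ (π / 4) with hle | hgt
  · exact ⟨θ₁, ⟨hθ₁0, hle⟩, by rw [hd1]⟩
  · refine ⟨π / 2 - θ₁, ⟨by linarith, by linarith⟩, ?_⟩
    have e : (fun x => f (π / 2 - x)) = f := by
      funext x
      rw [show π / 2 - x = -(x + (-1 : ℤ) * (π / 2)) by push_cast; ring, heven, periodic_int_mul_aux hper]
    have h := deriv_comp_const_sub f (π / 2) (π / 2 - θ₁)
    rw [e, sub_sub_cancel] at h
    rw [hd1, h, abs_neg]

/-! ## §4 A generic leaf test on the bisection tree -/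

/-- The tree checker of `…FreeBandRadiusDerivTree` with an arbitrary leaf test `p`. -/
def R1Tree.checkP (p : R1Box → Bool) : R1Tree → ℤ → ℤ → ℕ → ℕ → Bool → Bool
  | .leaf B, m1, m2, s1, s2, top =>
      decide (B.m1 ≤ m1) && decide (m2 ≤ B.m2) && decide (B.s1 ≤ s1) && (B.top == top) && (top || decide (s2 ≤ B.s2)) && p B
  | .splitMu m tlo thi, m1, m2, s1, s2, top => tlo.checkP p m1 m s1 s2 top && thi.checkP p m m2 s1 s2 top
  | .splitS σ tlo thi, m1, m2, s1, s2, top => tlo.checkP p m1 m2 s1 σ false && thi.checkP p m1 m2 σ s2 top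

/-- **Soundness of the generic tree checker** for any box-local property `P μ θ`. -/
theorem R1Tree.soundP {p : R1Box → Bool} {μ : ℝ} {P : ℝ → Prop}
    (hleaf : ∀ B : R1Box, p B = true → (B.m1 : ℝ) ≤ μ * 10 ^ 6 → μ * 10 ^ 6 ≤ (B.m2 : ℝ) → ∀ {θ : ℝ}, θ ∈ Icc 0 (π / 4) →
      (B.s1 : ℝ) ≤ Real.sin θ * 10 ^ 6 → (B.top = false → Real.sin θ * 10 ^ 6 ≤ (B.s2 : ℝ)) → P θ) :
    ∀ (t : R1Tree) (m1 m2 : ℤ) (s1 s2 : ℕ) (top : Bool), t.checkP p m1 m2 s1 s2 top = true →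
    (m1 : ℝ) ≤ μ * 10 ^ 6 → μ * 10 ^ 6 ≤ (m2 : ℝ) → ∀ {θ : ℝ}, θ ∈ Icc 0 (π / 4) → (s1 : ℝ) ≤ Real.sin θ * 10 ^ 6 →
    (top = false → Real.sin θ * 10 ^ 6 ≤ (s2 : ℝ)) → P θ
  | .leaf B, m1, m2, s1, s2, top, h, hm1, hm2, θ, hθ, hs1, hs2 => by
    simp only [R1Tree.checkP, Bool.and_eq_true, decide_eq_true_eq, beq_iff_eq, Bool.or_eq_true] at h
    obtain ⟨⟨⟨⟨⟨hB1, hB2⟩, hB3⟩, hBt⟩, hBs⟩, hp⟩ := h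
    have hB1' : (B.m1 : ℝ) ≤ m1 := by exact_mod_cast hB1
    have hB2' : (m2 : ℝ) ≤ B.m2 := by exact_mod_cast hB2
    have hB3' : (B.s1 : ℝ) ≤ s1 := by exact_mod_cast hB3
    refine hleaf B hp (hB1'.trans hm1) (hm2.trans hB2') hθ (hB3'.trans hs1) ?_
    intro hBtop
    rw [hBt] at hBtop
    rcases hBs with ht | hs
    · rw [hBtop] at ht; exact absurd ht (by decide)
    · have hs' : (s2 : ℝ) ≤ B.s2 := by exact_mod_cast hs
      exact (hs2 hBtop).trans hs'
  | .splitMu m tlo thi, m1, m2, s1, s2, top, h, hm1, hm2, θ, hθ, hs1, hs2 => by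
    simp only [R1Tree.checkP, Bool.and_eq_true] at h
    rcases le_total (μ * 10 ^ 6) (m : ℝ) with hle | hge
    · exact R1Tree.soundP hleaf tlo m1 m s1 s2 top h.1 hm1 hle hθ hs1 hs2
    · exact R1Tree.soundP hleaf thi m m2 s1 s2 top h.2 hge hm2 hθ hs1 hs2
  | .splitS σ tlo thi, m1, m2, s1, s2, top, h, hm1, hm2, θ, hθ, hs1, hs2 => by
    simp only [R1Tree.checkP, Bool.and_eq_true] at h
    rcases le_total (Real.sin θ * 10 ^ 6) (σ : ℝ) with hle | hge
    · exact R1Tree.soundP hleaf tlo m1 m2 s1 σ false h.1 hm1 hm2 hθ hs1 (fun _ => hle)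
    · exact R1Tree.soundP hleaf thi m1 m2 σ s2 top h.2 hm1 hm2 hθ hge hs2

end Summit.HubbardSuperconductivity.HubbardSuperconductivity.Theorems.PerturbedFermiCurve
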